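import Literature.InformationTheory.QuantumCodes.BivariateBicycleCodes
import HarnessLib

/-!
# Univariate bicycle (UB) codes (Rabeti–Mahdavifar 2026): the construction and the two printed instances as typed objects

Rabeti–Mahdavifar, *Univariate Bicycle Quantum LDPC Codes: Explicit Logical Structure and Distance Bounds*,
arXiv:2605.14173 [RabetiMahdavifar2026] (held text `paper:arxiv-2605.14173`).  §3 (chunk p0005 L3–18):
"Let `𝓡_n ≜ 𝔽₂[x]/(xⁿ − 1)`, and let `a(x) ∈ 𝔽₂[x]` … For an integer `ℓ ≥ 1`, define `b(x) ≜ a(x)^{2^ℓ}` in `𝓡_n`.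
Let `A = Circ(a(x))` and `B = Circ(b(x))` … The resulting CSS code `[[N = 2n, k, d]]` with parity-check matrices
`H_X = [A, B]`, `H_Z = [Bᵀ, Aᵀ]`, is called a univariate bicycle (UB) code, denoted by `UB(a(x), ℓ)`.  Equivalently …
`UB(a(x), ℓ) = GB(a(x), a(x)^t)` with `t = 2^ℓ`."  Lemma 2 (chunk p0005 L28–40, "The identity follows from the
Frobenius map over `𝔽₂`"): `b(x) = a(x^{2^ℓ}) = Σ_{i=0}^{n−1} a_i x^{2^ℓ i}` in `𝓡_n`; consequently `wt(b) ≤ wt(a)`,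
with equality for odd `n`.

This file types the construction in the tree's `QC(A, B)` vocabulary with `m = 1` (`BB.Code n 1`, group
`ℤ_n × ℤ_1 ≅ ℤ_n`, `A = a(x)`, `B = b(x)`, `H_X = [A|B]`, `H_Z = [Bᵀ|Aᵀ]` — `BivariateBicycleCodes.lean`; a UB code
is in particular a generalized-bicycle code over `ℤ_n`, cf. `GeneralizedBicycleCodesPK21.lean`), taking Lemma 2's
COEFFICIENT form as the definition of `b` (the tree's `BB.Poly` carries no ring structure, so the power `a^{2^ℓ}`
itself is not formed — `TODO(general form)` below):

* `BB.frobScale t a` — the polynomial `a(x^t) = Σ_i a_i x^{t·i mod n}` (Lemma 2's right-hand side, for any `t`;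
  collisions of exponents cancel mod 2, exactly as in `𝓡_n`);
* `BB.ub a ℓ : BB.Code n 1 := ⟨a, frobScale (2^ℓ) a⟩` — **the UB code `UB(a, ℓ)`** (definition of §3 via Lemma 2);
* the two PRINTED instances as DATA: `BB.ub42 = UB(1 + x + x² + x⁴, 1)` over `𝓡₂₁` (Example 1, chunk p0007
  L202–205: "Consider the code `[[42,8,5]] = UB(1+x+x²+x⁴, 1)` over `𝓡₂₁` … `f(x) = a(x)^{2¹−1} = 1+x+x²+x⁴`") and
  `BB.ub60 = UB(1 + x + x³ + x⁴, 5)` over `𝓡₃₀` (§4, chunk p0008 L9–24: "the following code over `𝓡₃₀`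
  `[[60,8,5]] = UB(1+x+x³+x⁴, 5)` satisfies `B₁^X = 15, B₂^X = 6`, while `d = ⌊B₃^X⌋ = ⌊5.0897⌋`"), each with the
  kernel identity spelling out `b`: `ub42_B : ub42.B = 1 + x² + x⁴ + x⁸`, `ub60_B : ub60.B = 1 + x² + x⁶ + x⁸`
  (`2⁵·{0,1,3,4} = {0,32,96,128} ≡ {0,2,6,8} mod 30`), by `decide`.

The printed parameters `[[42,8,5]]`, `[[60,8,5]]` are CLAIMS (LADDER-QEC rule) and are NOT asserted here (DATA only).
[Census note, not part of the statement: both are reproduced by the qec census — rows `UB42_UB26`, `UB60_UB26`,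
kernel A ∧ kernel B, `d = 5` exact, 2026-08-27.]

`-- TODO(general form): b = a^{2^ℓ}` as a POWER in `𝔽₂[x]/(xⁿ − 1)` and Lemma 2 `a^{2^ℓ} = a(x^{2^ℓ})` as a theorem
(Frobenius); needs a ring structure on `BB.Poly n 1` (e.g. via `AddMonoidAlgebra (ZMod 2) (ZMod n)`), not in the tree.

## References
* [RabetiMahdavifar2026] S. Rabeti, H. Mahdavifar, arXiv:2605.14173 (2026), §3 Definition + Lemma 2 (chunk p0005
  L3–40), Example 1 (chunk p0007 L202–205), §4 (chunk p0008 L9–24).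

## Tree search (2026-08-27)
`lean search 'nivariate'` → only unrelated univariate-polynomial files (Budan–Fourier …); no UB/Frobenius-scaled
two-block object in the tree.  Reused: `BB.Code`, `BB.Poly`, `BB.monomial`, `BB.xPow`.
-/

namespace Literature.InformationTheory.QuantumCodes

namespace BB

variable {n : ℕ} [NeZero n]

/-- `a(xᵗ)`: the polynomial `Σ_i a_i x^{t·i mod n}` of `𝔽₂[x]/(xⁿ − 1)` (as a `BB.Poly n 1`; exponent collisions
cancel mod 2).  For `t = 2^ℓ` this is `a(x)^{2^ℓ}` by the Frobenius identity (Lemma 2).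
[cite: RabetiMahdavifar2026, Lemma 2 (arXiv:2605.14173 chunk p0005 L28–40)] -/
def frobScale (t : ℕ) (a : Poly n 1) : Poly n 1 :=
  Finset.univ.sum fun i : Fin n => if a (i, 0) = 0 then 0 else monomial (Fin.ofNat n (t * i.val)) 0

/-- **The univariate bicycle code `UB(a, ℓ) = GB(a(x), a(x^{2^ℓ}))`** over `ℤ_n` (`= GB(a, a^{2^ℓ})` by Lemma 2),
as a `QC(A, B)` with `m = 1`.
[cite: RabetiMahdavifar2026, §3 Definition (arXiv:2605.14173 chunk p0005 L3–18) and Lemma 2 (chunk p0005 L28–40)] -/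
def ub (a : Poly n 1) (ℓ : ℕ) : Code n 1 := ⟨a, frobScale (2 ^ ℓ) a⟩

/-- Example 1: **`UB(1 + x + x² + x⁴, 1)` over `𝓡₂₁`**, printed `[[42, 8, 5]]` ("Consider the code
`[[42,8,5]] = UB(1+x+x²+x⁴, 1)` over `𝓡₂₁`", chunk p0007 L202–205).  Check weight `4 + 4 = 8`.  DATA; the printed
parameters are a CLAIM, not asserted.
[cite: RabetiMahdavifar2026, Example 1 (arXiv:2605.14173 chunk p0007 L202–205)] -/
def ub42 : Code 21 1 := ub (xPow 0 + xPow 1 + xPow 2 + xPow 4) 1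

/-- §4: **`UB(1 + x + x³ + x⁴, 5)` over `𝓡₃₀`**, printed `[[60, 8, 5]]` ("`[[60,8,5]] = UB(1+x+x³+x⁴, 5)` satisfies
`B₁^X = 15, B₂^X = 6`, while `d = ⌊B₃^X⌋ = ⌊5.0897⌋`", chunk p0008 L9–24).  Check weight `8`.  DATA; the printed
parameters are a CLAIM, not asserted.
[cite: RabetiMahdavifar2026, §4 (arXiv:2605.14173 chunk p0008 L9–24)] -/
def ub60 : Code 30 1 := ub (xPow 0 + xPow 1 + xPow 3 + xPow 4) 5

/-- `ub42.A = 1 + x + x² + x⁴`. [cite: RabetiMahdavifar2026, Example 1 (arXiv:2605.14173 chunk p0007 L202–205)] -/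
theorem ub42_A : ub42.A = xPow 0 + xPow 1 + xPow 2 + xPow 4 := rfl

/-- Lemma 2 evaluated: `ub42.B = a(x²) = 1 + x² + x⁴ + x⁸` in `𝓡₂₁` (`decide`).
[cite: RabetiMahdavifar2026, Lemma 2 and Example 1 (arXiv:2605.14173 chunk p0005 L28–40, p0007 L202–205)] -/
theorem ub42_B : ub42.B = xPow 0 + xPow 2 + xPow 4 + xPow 8 := by
  funext g; revert g; decide +kernel

/-- `ub60.A = 1 + x + x³ + x⁴`. [cite: RabetiMahdavifar2026, §4 (arXiv:2605.14173 chunk p0008 L9–24)] -/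
theorem ub60_A : ub60.A = xPow 0 + xPow 1 + xPow 3 + xPow 4 := rfl

/-- Lemma 2 evaluated: `ub60.B = a(x³²) = a(x²) = 1 + x² + x⁶ + x⁸` in `𝓡₃₀` (`2⁵·{0,1,3,4} ≡ {0,2,6,8} mod 30`;
`decide`). [cite: RabetiMahdavifar2026, Lemma 2 and §4 (arXiv:2605.14173 chunk p0005 L28–40, p0008 L9–24)] -/
theorem ub60_B : ub60.B = xPow 0 + xPow 2 + xPow 6 + xPow 8 := by
  funext g; revert g; decide +kernel

/-- Lemma 2, weight clause, on the instances: `wt(b) = wt(a) = 4` for `ub42` (`n = 21` odd) and for `ub60`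
(no collision for this `a` although `n = 30` is even) — as the supports above show (`decide`).
[cite: RabetiMahdavifar2026, Lemma 2 (arXiv:2605.14173 chunk p0005 L28–40)] -/
theorem ub42_B_support_card :
    (Finset.univ.filter fun g : Mono 21 1 => ub42.B g ≠ 0).card = 4 ∧
    (Finset.univ.filter fun g : Mono 30 1 => ub60.B g ≠ 0).card = 4 := by
  constructor <;> decide +kernel

end BB

end Literature.InformationTheory.QuantumCodes
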